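import Summits.AtomisticToContinuum.HydrodynamicLimit.Theorems.ImplosionDichotomyPolynomialCompressionLevel3Defs
import Summits.AtomisticToContinuum.HydrodynamicLimit.Theorems.ImplosionDichotomyPolynomialCompressionLevel2Forcing

/-!
# Level-3 forcing minus its top-order part: crude pointwise bound, density component

Helper file for the line `log-lipschitz-budget` of the crux `ImplosionDichotomy.PolynomialCompression`
(stmt-AtomisticToContinuum-12587), stub `stub_logBudgetShadowing` (level-3 estimate, crude part). For the
σ-solution `(ρ,u,θ)`, the ideal-gas reference `(ρ₁,u₁,θ₁)` and a word `(l,m,n)`, the density component `l3Fρ` of the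
frozen operator at `W = ∂ₙ∂ₘ∂ₗ δV` equals its top-order part `l3Topρ` up to `l3Rem M Z S₂ S₃ d₀ d₁ d₂`
(vocabulary: `…Level3Defs`): the level-3 forcing identity (one commutator step `hsEuler_frozen_commutator_density`
on `hsEuler_level2_forcing_density`, as in `hsEuler_level3_forcing_density`), linearity of `Torus.partialDeriv`
and the Leibniz remainders of `Torus.partialDeriv₂_mul_sub`, `Torus.partialDeriv₃_mul_sub`.
-/

noncomputable section

namespace Summit.AtomisticToContinuum.HydrodynamicLimit.Theorems

open Set MeasureTheory
open Literature.MathematicalPhysics.KineticTheory Literature.Analysis.FunctionSpaces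

/-- Differences of smooth scalar functions (lambda form). [folklore] -/
private theorem l3cd_sub {f g : T3 → ℝ} (hf : Torus.IsSmooth f) (hg : Torus.IsSmooth g) :
    Torus.IsSmooth (fun y => f y - g y) := hf.sub hg

/-- Sums of smooth scalar functions (lambda form). [folklore] -/
private theorem l3cd_add {f g : T3 → ℝ} (hf : Torus.IsSmooth f) (hg : Torus.IsSmooth g) :
    Torus.IsSmooth (fun y => f y + g y) := hf.add hg

/-- Negatives of smooth scalar functions (lambda form). [folklore] -/
private theorem l3cd_neg {f : T3 → ℝ} (hf : Torus.IsSmooth f) : Torus.IsSmooth (fun y => -f y) := hf.neg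

/-- Products of smooth scalar functions (lambda form). [folklore] -/
private theorem l3cd_mul {f g : T3 → ℝ} (hf : Torus.IsSmooth f) (hg : Torus.IsSmooth g) :
    Torus.IsSmooth (fun y => f y * g y) :=
  (ContDiff.mul hf hg : Torus.IsSmooth fun y => f y * g y)

/-- Finite sums over `Fin 3` of smooth scalar functions (lambda form). [folklore] -/
private theorem l3cd_sum {F : Fin 3 → T3 → ℝ} (hF : ∀ i, Torus.IsSmooth (F i)) :
    Torus.IsSmooth (fun y => ∑ i, F i y) := by
  have hl : Torus.lift (fun y => ∑ i, F i y) = fun z => ∑ i, Torus.lift (F i) z := rfl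
  unfold Torus.IsSmooth
  rw [hl]
  exact ContDiff.sum fun i _ => hF i

/-- `∂ᵢ(F - G) = ∂ᵢF - ∂ᵢG` as functions (lambda form). [folklore] -/
private theorem l3cd_dsub {F G : T3 → ℝ} (hF : Torus.IsSmooth F) (hG : Torus.IsSmooth G) (i : Fin 3) :
    Torus.partialDeriv i (fun y => F y - G y) =
      fun y => Torus.partialDeriv i F y - Torus.partialDeriv i G y :=
  funext fun y => partialDeriv_sub_fields (hF.isContDiff (by simp)) (hG.isContDiff (by simp)) i y

/-- `∂ᵢ(F + G) = ∂ᵢF + ∂ᵢG` as functions (lambda form). [folklore] -/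
private theorem l3cd_dadd {F G : T3 → ℝ} (hF : Torus.IsSmooth F) (hG : Torus.IsSmooth G) (i : Fin 3) :
    Torus.partialDeriv i (fun y => F y + G y) =
      fun y => Torus.partialDeriv i F y + Torus.partialDeriv i G y :=
  Torus.partialDeriv_add (hF.isContDiff (by simp)) (hG.isContDiff (by simp)) i

/-- `∂ᵢ(Σₘ Fₘ) = Σₘ ∂ᵢFₘ` as functions (lambda form). [folklore] -/
private theorem l3cd_dsum {F : Fin 3 → T3 → ℝ} (hF : ∀ m, Torus.IsSmooth (F m)) (i : Fin 3) :
    Torus.partialDeriv i (fun y => ∑ m, F m y) = fun y => ∑ m, Torus.partialDeriv i (F m) y :=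
  funext fun y => Torus.partialDeriv_finset_sum Finset.univ (fun m _ => (hF m).isContDiff (by simp)) i y

/-- `∂ᵢ(F + G) = ∂ᵢF + ∂ᵢG` at a point (lambda form). [folklore] -/
private theorem l3cd_add₁ {F G : T3 → ℝ} (hF : Torus.IsSmooth F) (hG : Torus.IsSmooth G) (i : Fin 3)
    (x : T3) :
    Torus.partialDeriv i (fun y => F y + G y) x = Torus.partialDeriv i F x + Torus.partialDeriv i G x :=
  congr_fun (l3cd_dadd hF hG i) x

/-- `∂ₖ∂ⱼ∂ᵢ(-F) = -∂ₖ∂ⱼ∂ᵢF` at a point (lambda form). [folklore] -/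
private theorem l3cd_neg₃ {F : T3 → ℝ} (hF : Torus.IsSmooth F) (i j k : Fin 3) (x : T3) :
    Torus.partialDeriv k (Torus.partialDeriv j (Torus.partialDeriv i (fun y => -F y))) x =
      -Torus.partialDeriv k (Torus.partialDeriv j (Torus.partialDeriv i F)) x := by
  have e : (fun y => -F y) = fun y => (-1 : ℝ) * F y := funext fun y => (neg_one_mul (F y)).symm
  rw [e, (Torus.partialDeriv₃_const_mul hF (-1) i j k x).2.2, neg_one_mul]

/-- Coordinates of first and second derivatives of a difference of smooth vector fields, in scalar
coordinate form. [folklore] -/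
private theorem l3cd_coord {v v₁ : T3 → V3} (hv : Torus.IsSmooth v) (hv₁ : Torus.IsSmooth v₁)
    (l m i : Fin 3) (y : T3) :
    Torus.partialDeriv l (fun z => v z - v₁ z) y i = Torus.partialDeriv l (fun z => v z i - v₁ z i) y ∧
    Torus.partialDeriv m (Torus.partialDeriv l (fun z => v z - v₁ z)) y i =
      Torus.partialDeriv m (Torus.partialDeriv l (fun z => v z i - v₁ z i)) y := by
  have hδ : Torus.IsSmooth (fun z => v z - v₁ z) := hv.sub hv₁
  have e₀ : (fun y => (fun z => v z - v₁ z) y i) = fun z => v z i - v₁ z i := by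
    funext z; simp only [PiLp.sub_apply]
  have h1 : ∀ y, Torus.partialDeriv l (fun z => v z - v₁ z) y i =
      Torus.partialDeriv l (fun z => v z i - v₁ z i) y := fun y => by
    rw [← Torus.partialDeriv_apply_coord (hδ.isContDiff (by simp)) l y i, e₀]
  refine ⟨h1 y, ?_⟩
  have e₁ : (fun y => Torus.partialDeriv l (fun z => v z - v₁ z) y i) =
      Torus.partialDeriv l (fun z => v z i - v₁ z i) := funext h1
  rw [← Torus.partialDeriv_apply_coord ((hδ.partialDeriv l).isContDiff (by simp)) m y i, e₁]

/-- `|a| ≤ A`, `|b| ≤ B` give `|ab| ≤ AB`. [folklore] -/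
private theorem l3cd_mm {a b A B : ℝ} (ha : |a| ≤ A) (hb : |b| ≤ B) : |a * b| ≤ A * B := by
  rw [abs_mul]; exact mul_le_mul ha hb (abs_nonneg _) ((abs_nonneg _).trans ha)

/-- Order two, top-order part on the first factor kept undifferentiated:
`|∂ₙ∂ₘ(fg) - f ∂ₙ∂ₘg| ≤ 2f₁g₁ + f₂g₀` (from `Torus.partialDeriv₂_mul_sub`). [folklore] -/
private theorem l3cd_rem₂ {f g : T3 → ℝ} {x : T3} {f₁ f₂ g₀ g₁ : ℝ} (hf : Torus.IsSmooth f)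
    (hg : Torus.IsSmooth g) (hf₁ : ∀ i, |Torus.partialDeriv i f x| ≤ f₁)
    (hf₂ : ∀ i j, |Torus.partialDeriv j (Torus.partialDeriv i f) x| ≤ f₂) (hg₀ : |g x| ≤ g₀)
    (hg₁ : ∀ i, |Torus.partialDeriv i g x| ≤ g₁) (m n : Fin 3) :
    |Torus.partialDeriv n (Torus.partialDeriv m (fun y => f y * g y)) x -
        f x * Torus.partialDeriv n (Torus.partialDeriv m g) x| ≤ 2 * (f₁ * g₁) + f₂ * g₀ := by
  rw [Torus.partialDeriv₂_mul_sub hf hg m n x]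
  have t1 := l3cd_mm (hf₂ m n) hg₀
  have t2 := l3cd_mm (hf₁ m) (hg₁ n)
  have t3 := l3cd_mm (hf₁ n) (hg₁ m)
  rw [abs_le]
  constructor <;> linarith [(abs_le.mp t1).1, (abs_le.mp t1).2, (abs_le.mp t2).1, (abs_le.mp t2).2,
    (abs_le.mp t3).1, (abs_le.mp t3).2]

/-- Order three, top-order part on the first factor (the differentiated one):
`|∂ₙ∂ₘ∂ₗ(fg) - (∂ₙ∂ₘ∂ₗf) g| ≤ 3f₂g₁ + 3f₁g₂ + f₀g₃` (from `Torus.partialDeriv₃_mul_sub`). [folklore] -/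
private theorem l3cd_rem₃ {f g : T3 → ℝ} {x : T3} {f₀ f₁ f₂ g₁ g₂ g₃ : ℝ} (hf : Torus.IsSmooth f)
    (hg : Torus.IsSmooth g) (hf₀ : |f x| ≤ f₀) (hf₁ : ∀ i, |Torus.partialDeriv i f x| ≤ f₁)
    (hf₂ : ∀ i j, |Torus.partialDeriv j (Torus.partialDeriv i f) x| ≤ f₂)
    (hg₁ : ∀ i, |Torus.partialDeriv i g x| ≤ g₁)
    (hg₂ : ∀ i j, |Torus.partialDeriv j (Torus.partialDeriv i g) x| ≤ g₂)
    (hg₃ : ∀ i j k, |Torus.partialDeriv k (Torus.partialDeriv j (Torus.partialDeriv i g)) x| ≤ g₃)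
    (l m n : Fin 3) :
    |Torus.partialDeriv n (Torus.partialDeriv m (Torus.partialDeriv l (fun y => f y * g y))) x -
        Torus.partialDeriv n (Torus.partialDeriv m (Torus.partialDeriv l f)) x * g x| ≤
      3 * (f₂ * g₁) + 3 * (f₁ * g₂) + f₀ * g₃ := by
  have e : (fun y => f y * g y) = fun y => g y * f y := funext fun y => mul_comm _ _
  rw [e, mul_comm _ (g x), Torus.partialDeriv₃_mul_sub hg hf l m n x]
  have t1 := l3cd_mm (hg₃ l m n) hf₀
  have t2 := l3cd_mm (hg₂ l m) (hf₁ n)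
  have t3 := l3cd_mm (hg₂ l n) (hf₁ m)
  have t4 := l3cd_mm (hg₁ l) (hf₂ m n)
  have t5 := l3cd_mm (hg₂ m n) (hf₁ l)
  have t6 := l3cd_mm (hg₁ m) (hf₂ l n)
  have t7 := l3cd_mm (hg₁ n) (hf₂ l m)
  rw [abs_le]
  constructor <;> linarith [(abs_le.mp t1).1, (abs_le.mp t1).2, (abs_le.mp t2).1, (abs_le.mp t2).2,
    (abs_le.mp t3).1, (abs_le.mp t3).2, (abs_le.mp t4).1, (abs_le.mp t4).2, (abs_le.mp t5).1,
    (abs_le.mp t5).2, (abs_le.mp t6).1, (abs_le.mp t6).2, (abs_le.mp t7).1, (abs_le.mp t7).2]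

/-- Linear expansion of the nested right-hand side of the level-3 density forcing into
`-∂³(δρ · div u₁) - Σᵢ ∂³(δuᵢ ∂ᵢρ₁) - [Σᵢ ∂²(∂ₗuᵢ ∂ᵢδρ) + ∂²(∂ₗρ Σᵢ∂ᵢδuᵢ)] - [Σᵢ ∂(∂ₘuᵢ ∂ᵢ∂ₗδρ) +
∂(∂ₘρ Σᵢ∂ᵢ∂ₗδuᵢ)] - C_n`, all `δ`-fields in scalar coordinate form (generic smooth slices
`r, r₁, v, v₁`). [folklore] -/
private theorem l3cd_expand {r r₁ : T3 → ℝ} {v v₁ : T3 → V3} (hr : Torus.IsSmooth r)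
    (hr₁ : Torus.IsSmooth r₁) (hv : Torus.IsSmooth v) (hv₁ : Torus.IsSmooth v₁) (x : T3) (l m n : Fin 3) :
    Torus.partialDeriv n (fun y₂ =>
        Torus.partialDeriv m (fun y₁ =>
          Torus.partialDeriv l (fun y =>
            -((r y - r₁ y) * ∑ i, Torus.partialDeriv i (fun z => v₁ z i) y) -
            ∑ i, (v y i - v₁ y i) * Torus.partialDeriv i r₁ y) y₁ -
          (∑ i, Torus.partialDeriv l (fun y => v y i) y₁ *
              Torus.partialDeriv i (fun y => r y - r₁ y) y₁ +
            Torus.partialDeriv l r y₁ *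
              ∑ i, Torus.partialDeriv i (fun y => (v y - v₁ y) i) y₁)) y₂ -
        (∑ i, Torus.partialDeriv m (fun y => v y i) y₂ *
            Torus.partialDeriv i (Torus.partialDeriv l (fun y => r y - r₁ y)) y₂ +
          Torus.partialDeriv m r y₂ *
            ∑ i, Torus.partialDeriv i
              (fun y => Torus.partialDeriv l (fun z => v z - v₁ z) y i) y₂)) x -
      (∑ i, Torus.partialDeriv n (fun y => v y i) x *
          Torus.partialDeriv i (Torus.partialDeriv m (Torus.partialDeriv l (fun y => r y - r₁ y))) x +
        Torus.partialDeriv n r x *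
          ∑ i, Torus.partialDeriv i
            (fun y => (Torus.partialDeriv m (Torus.partialDeriv l (fun z => v z - v₁ z))) y i) x) =
    -Torus.partialDeriv n (Torus.partialDeriv m (Torus.partialDeriv l
        (fun y => (r y - r₁ y) * ∑ i, Torus.partialDeriv i (fun z => v₁ z i) y))) x -
      ∑ i, Torus.partialDeriv n (Torus.partialDeriv m (Torus.partialDeriv l
        (fun y => (v y i - v₁ y i) * Torus.partialDeriv i r₁ y))) x -
      (∑ i, Torus.partialDeriv n (Torus.partialDeriv m (fun y =>
          Torus.partialDeriv l (fun z => v z i) y * Torus.partialDeriv i (fun z => r z - r₁ z) y)) x +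
        Torus.partialDeriv n (Torus.partialDeriv m (fun y =>
          Torus.partialDeriv l r y * ∑ i, Torus.partialDeriv i (fun z => v z i - v₁ z i) y)) x) -
      (∑ i, Torus.partialDeriv n (fun y =>
          Torus.partialDeriv m (fun z => v z i) y *
            Torus.partialDeriv i (Torus.partialDeriv l (fun z => r z - r₁ z)) y) x +
        Torus.partialDeriv n (fun y =>
          Torus.partialDeriv m r y *
            ∑ i, Torus.partialDeriv i (Torus.partialDeriv l (fun z => v z i - v₁ z i)) y) x) -
      (∑ i, Torus.partialDeriv n (fun y => v y i) x *
          Torus.partialDeriv i (Torus.partialDeriv m (Torus.partialDeriv l (fun y => r y - r₁ y))) x +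
        Torus.partialDeriv n r x *
          ∑ i, Torus.partialDeriv i (Torus.partialDeriv m (Torus.partialDeriv l
            (fun y => v y i - v₁ y i))) x) := by
  have hδr : Torus.IsSmooth (fun y => r y - r₁ y) := l3cd_sub hr hr₁
  have hδv : Torus.IsSmooth (fun z => v z - v₁ z) := hv.sub hv₁
  have hvi : ∀ i, Torus.IsSmooth (fun y => v y i) := fun i => hv.apply i
  have hv₁i : ∀ i, Torus.IsSmooth (fun z => v₁ z i) := fun i => hv₁.apply i
  have hδvi : ∀ i, Torus.IsSmooth (fun y => v y i - v₁ y i) := fun i => l3cd_sub (hvi i) (hv₁i i)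
  have hA : Torus.IsSmooth (fun y => (r y - r₁ y) * ∑ i, Torus.partialDeriv i (fun z => v₁ z i) y) :=
    l3cd_mul hδr (l3cd_sum fun i => (hv₁i i).partialDeriv i)
  have hB : ∀ i, Torus.IsSmooth (fun y => (v y i - v₁ y i) * Torus.partialDeriv i r₁ y) :=
    fun i => l3cd_mul (hδvi i) (hr₁.partialDeriv i)
  have hnA := l3cd_neg hA
  have hsB := l3cd_sum hB
  have hf := l3cd_sub hnA hsB
  have hCl1 : ∀ i, Torus.IsSmooth (fun y₁ => Torus.partialDeriv l (fun y => v y i) y₁ *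
      Torus.partialDeriv i (fun y => r y - r₁ y) y₁) :=
    fun i => l3cd_mul ((hvi i).partialDeriv l) (hδr.partialDeriv i)
  have hsCl1 := l3cd_sum hCl1
  have hCl2 : Torus.IsSmooth (fun y₁ => Torus.partialDeriv l r y₁ *
      ∑ i, Torus.partialDeriv i (fun y => (v y - v₁ y) i) y₁) :=
    l3cd_mul (hr.partialDeriv l) (l3cd_sum fun i => (hδv.apply i).partialDeriv i)
  have hCl := l3cd_add hsCl1 hCl2
  have hCm1 : ∀ i, Torus.IsSmooth (fun y₂ => Torus.partialDeriv m (fun y => v y i) y₂ *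
      Torus.partialDeriv i (Torus.partialDeriv l (fun y => r y - r₁ y)) y₂) :=
    fun i => l3cd_mul ((hvi i).partialDeriv m) ((hδr.partialDeriv l).partialDeriv i)
  have hsCm1 := l3cd_sum hCm1
  have hCm2 : Torus.IsSmooth (fun y₂ => Torus.partialDeriv m r y₂ *
      ∑ i, Torus.partialDeriv i (fun y => Torus.partialDeriv l (fun z => v z - v₁ z) y i) y₂) :=
    l3cd_mul (hr.partialDeriv m) (l3cd_sum fun i => ((hδv.partialDeriv l).apply i).partialDeriv i)
  have hCm := l3cd_add hsCm1 hCm2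
  have c1 : ∀ (G : T3 → ℝ), Torus.IsSmooth G → Torus.IsContDiff 1 G := fun G hG => hG.isContDiff (by simp)
  rw [partialDeriv_sub_fields (c1 _ ((l3cd_sub (hf.partialDeriv l) hCl).partialDeriv m)) (c1 _ hCm) n x,
    l3cd_dsub (hf.partialDeriv l) hCl m,
    partialDeriv_sub_fields (c1 _ ((hf.partialDeriv l).partialDeriv m)) (c1 _ (hCl.partialDeriv m)) n x,
    l3cd_dsub hnA hsB l, l3cd_dsub (hnA.partialDeriv l) (hsB.partialDeriv l) m,
    partialDeriv_sub_fields (c1 _ ((hnA.partialDeriv l).partialDeriv m))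
      (c1 _ ((hsB.partialDeriv l).partialDeriv m)) n x,
    l3cd_neg₃ hA l m n x, l3cd_dsum hB l, l3cd_dsum (fun i => (hB i).partialDeriv l) m,
    Torus.partialDeriv_finset_sum Finset.univ (fun i _ => c1 _ (((hB i).partialDeriv l).partialDeriv m)) n x,
    l3cd_dadd hsCl1 hCl2 m, l3cd_add₁ (hsCl1.partialDeriv m) (hCl2.partialDeriv m) n x, l3cd_dsum hCl1 m,
    Torus.partialDeriv_finset_sum Finset.univ (fun i _ => c1 _ ((hCl1 i).partialDeriv m)) n x,
    l3cd_add₁ hsCm1 hCm2 n x, Torus.partialDeriv_finset_sum Finset.univ (fun i _ => c1 _ (hCm1 i)) n x]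
  have e1 : ∀ i y, Torus.partialDeriv l (fun z => v z - v₁ z) y i =
      Torus.partialDeriv l (fun z => v z i - v₁ z i) y := fun i y => (l3cd_coord hv hv₁ l m i y).1
  have e2 : ∀ i y, Torus.partialDeriv m (Torus.partialDeriv l (fun z => v z - v₁ z)) y i =
      Torus.partialDeriv m (Torus.partialDeriv l (fun z => v z i - v₁ z i)) y :=
    fun i y => (l3cd_coord hv hv₁ l m i y).2
  simp only [PiLp.sub_apply, e1, e2]

/-- **Level-3 forcing identity, density component**, reference `(ρ₁, u₁)` (one commutator step
`hsEuler_frozen_commutator_density` on `hsEuler_level2_forcing_density`; re-derived here because the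
module `…Level3Forcing` is not imported). [folklore] -/
private theorem l3cd_identity :
    ∀ {σ T : ℝ} {ρ θ ρ₁ θ₁ : ℝ → T3 → ℝ} {u u₁ : ℝ → T3 → V3},
      IsHardSphereEulerSolution σ T ρ u θ → IsHardSphereEulerSolution 0 T ρ₁ u₁ θ₁ →
      ∀ {t : ℝ}, t ∈ Ico 0 T → ∀ (x : T3) (l m n : Fin 3),
        l3Fρ T ρ ρ₁ u u₁ t x l m n =
          Torus.partialDeriv n (fun y₂ =>
              Torus.partialDeriv m (fun y₁ =>
                  Torus.partialDeriv l (fun y =>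
                      -((ρ t y - ρ₁ t y) * ∑ i, Torus.partialDeriv i (fun z => u₁ t z i) y) -
                        ∑ i, (u t y i - u₁ t y i) * Torus.partialDeriv i (ρ₁ t) y) y₁ -
                    (∑ i, Torus.partialDeriv l (fun y => u t y i) y₁ *
                        Torus.partialDeriv i (fun y => ρ t y - ρ₁ t y) y₁ +
                      Torus.partialDeriv l (ρ t) y₁ *
                        ∑ i, Torus.partialDeriv i (fun y => (u t y - u₁ t y) i) y₁)) y₂ -
                (∑ i, Torus.partialDeriv m (fun y => u t y i) y₂ *
                    Torus.partialDeriv i (Torus.partialDeriv l (fun y => ρ t y - ρ₁ t y)) y₂ +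
                  Torus.partialDeriv m (ρ t) y₂ * ∑ i, Torus.partialDeriv i
                    (fun y => Torus.partialDeriv l (fun z => u t z - u₁ t z) y i) y₂)) x -
            (∑ i, Torus.partialDeriv n (fun y => u t y i) x *
                Torus.partialDeriv i (Torus.partialDeriv m (Torus.partialDeriv l
                  (fun y => ρ t y - ρ₁ t y))) x +
              Torus.partialDeriv n (ρ t) x *
                ∑ i, Torus.partialDeriv i (fun y => (Torus.partialDeriv m (Torus.partialDeriv l
                  (fun z => u t z - u₁ t z))) y i) x) := by
  intro σ T ρ θ ρ₁ θ₁ u u₁ hE hE₁ t ht x l m n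
  have hU := uniqueDiffOn_Ico 0 T
  have hα : Torus.IsSmoothSpaceTimeOn (Ico 0 T)
      (fun s => Torus.partialDeriv m (Torus.partialDeriv l (fun y => ρ s y - ρ₁ s y))) :=
    ((hE.smooth_density.sub hE₁.smooth_density).partialDeriv hU l).partialDeriv hU m
  have hw : Torus.IsSmoothSpaceTimeOn (Ico 0 T)
      (fun s => Torus.partialDeriv m (Torus.partialDeriv l (fun y => u s y - u₁ s y))) :=
    ((hE.smooth_velocity.sub hE₁.smooth_velocity).partialDeriv hU l).partialDeriv hU m
  have hJc := hsEuler_frozen_commutator_density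
    (α := fun s => Torus.partialDeriv m (Torus.partialDeriv l (fun y => ρ s y - ρ₁ s y)))
    (w := fun s => Torus.partialDeriv m (Torus.partialDeriv l (fun y => u s y - u₁ s y))) hE hα hw ht x n
  have hfun : (fun y => Torus.timeDerivWithin (Ico 0 T)
          (fun s => Torus.partialDeriv m (Torus.partialDeriv l (fun y => ρ s y - ρ₁ s y))) t y +
        ∑ i, u t y i * Torus.partialDeriv i
          (Torus.partialDeriv m (Torus.partialDeriv l (fun y => ρ t y - ρ₁ t y))) y +
        ρ t y * ∑ i, Torus.partialDeriv i
          (fun z => Torus.partialDeriv m (Torus.partialDeriv l (fun y => u t y - u₁ t y)) z i) y) =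
      fun y₂ =>
        Torus.partialDeriv m (fun y₁ =>
            Torus.partialDeriv l (fun y =>
                -((ρ t y - ρ₁ t y) * ∑ i, Torus.partialDeriv i (fun z => u₁ t z i) y) -
                  ∑ i, (u t y i - u₁ t y i) * Torus.partialDeriv i (ρ₁ t) y) y₁ -
              (∑ i, Torus.partialDeriv l (fun y => u t y i) y₁ *
                  Torus.partialDeriv i (fun y => ρ t y - ρ₁ t y) y₁ +
                Torus.partialDeriv l (ρ t) y₁ *
                  ∑ i, Torus.partialDeriv i (fun y => (u t y - u₁ t y) i) y₁)) y₂ -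
          (∑ i, Torus.partialDeriv m (fun y => u t y i) y₂ *
              Torus.partialDeriv i (Torus.partialDeriv l (fun y => ρ t y - ρ₁ t y)) y₂ +
            Torus.partialDeriv m (ρ t) y₂ * ∑ i, Torus.partialDeriv i
              (fun y => Torus.partialDeriv l (fun z => u t z - u₁ t z) y i) y₂) :=
    funext fun y => hsEuler_level2_forcing_density hE hE₁ ht y l m
  unfold l3Fρ
  rw [hJc, hfun]

/-- The seven-group bookkeeping behind the crude bound: termwise remainders add up. [folklore] -/
private theorem l3cd_alg {a a' dd dd' f f' g R B₁ B₂ B₃ B₄ B₅ B₆ : ℝ} {b b' c c' e e' : Fin 3 → ℝ}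
    (ha : |a - a'| ≤ B₁) (hb : ∀ i, |b i - b' i| ≤ B₂) (hc : ∀ i, |c i - c' i| ≤ B₃)
    (hd : |dd - dd'| ≤ B₄) (he : ∀ i, |e i - e' i| ≤ B₅) (hf : |f - f'| ≤ B₆)
    (hR : B₁ + 3 * B₂ + 3 * B₃ + B₄ + 3 * B₅ + B₆ ≤ R) :
    |(-a - ∑ i, b i - (∑ i, c i + dd) - (∑ i, e i + f) - g) -
        (-a' - ∑ i, b' i - (∑ i, c' i + dd') - (∑ i, e' i + f') - g)| ≤ R := by
  simp only [Fin.sum_univ_three]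
  rw [abs_le]
  constructor <;> nlinarith [(abs_le.mp ha).1, (abs_le.mp ha).2, (abs_le.mp (hb 0)).1, (abs_le.mp (hb 0)).2,
    (abs_le.mp (hb 1)).1, (abs_le.mp (hb 1)).2, (abs_le.mp (hb 2)).1, (abs_le.mp (hb 2)).2,
    (abs_le.mp (hc 0)).1, (abs_le.mp (hc 0)).2, (abs_le.mp (hc 1)).1, (abs_le.mp (hc 1)).2,
    (abs_le.mp (hc 2)).1, (abs_le.mp (hc 2)).2, (abs_le.mp hd).1, (abs_le.mp hd).2,
    (abs_le.mp (he 0)).1, (abs_le.mp (he 0)).2, (abs_le.mp (he 1)).1, (abs_le.mp (he 1)).2,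
    (abs_le.mp (he 2)).1, (abs_le.mp (he 2)).2, (abs_le.mp hf).1, (abs_le.mp hf).2]

/-- **Crude bound, density component.** [folklore] -/
theorem level3_crude_density :
    ∀ {σ T : ℝ} {ρ θ ρ₁ θ₁ : ℝ → T3 → ℝ} {u u₁ : ℝ → T3 → V3} {ζ : ℝ → ℝ} {t : ℝ} {x : T3}
      {M Z S₂ S₃ d₀ d₁ d₂ : ℝ},
      IsHardSphereEulerSolution σ T ρ u θ → IsHardSphereEulerSolution 0 T ρ₁ u₁ θ₁ → t ∈ Ico 0 T →
      0 ≤ M → 0 ≤ Z → 0 ≤ S₂ → 0 ≤ S₃ → 0 ≤ d₀ → 0 ≤ d₁ → 0 ≤ d₂ →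
      Level3Coeff ζ ρ θ ρ₁ θ₁ u u₁ t x M Z S₂ S₃ → Level3Jets ρ θ ρ₁ θ₁ u u₁ t x d₀ d₁ d₂ →
      ∀ (l m n : Fin 3),
        |l3Fρ T ρ ρ₁ u u₁ t x l m n - l3Topρ ρ ρ₁ u u₁ t x l m n| ≤ l3Rem M Z S₂ S₃ d₀ d₁ d₂ := by
  intro σ T ρ θ ρ₁ θ₁ u u₁ ζ t x M Z S₂ S₃ d₀ d₁ d₂ hE hE₁ ht hM hZ hS₂ hS₃ hd₀ hd₁ hd₂ hC hJ l m n
  obtain ⟨hu1, hu2, hu3, hρ1, hρ2, hρ3, -, -, -, hD, hR, -⟩ := hC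
  obtain ⟨hJρ0, -, hJu0, hJρ1, -, hJu1, hJρ2, -, hJu2⟩ := hJ
  have hr : Torus.IsSmooth (ρ t) := hE.smooth_density.isSmooth_slice ht
  have hr₁ : Torus.IsSmooth (ρ₁ t) := hE₁.smooth_density.isSmooth_slice ht
  have hv : Torus.IsSmooth (u t) := hE.smooth_velocity.isSmooth_slice ht
  have hv₁ : Torus.IsSmooth (u₁ t) := hE₁.smooth_velocity.isSmooth_slice ht
  have hδr : Torus.IsSmooth (fun y => ρ t y - ρ₁ t y) := l3cd_sub hr hr₁
  have hvi : ∀ i, Torus.IsSmooth (fun y => u t y i) := fun i => hv.apply i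
  have hv₁i : ∀ i, Torus.IsSmooth (fun z => u₁ t z i) := fun i => hv₁.apply i
  have hδvi : ∀ i, Torus.IsSmooth (fun y => u t y i - u₁ t y i) := fun i => l3cd_sub (hvi i) (hv₁i i)
  have hDs := l3cd_sum fun i => (hv₁i i).partialDeriv i
  have hG1 := l3cd_sum fun i => (hδvi i).partialDeriv i
  have hG2 := l3cd_sum fun i => ((hδvi i).partialDeriv l).partialDeriv i
  rw [l3cd_identity hE hE₁ ht x l m n, l3cd_expand hr hr₁ hv hv₁ x l m n]
  unfold l3Topρ
  have b1 := l3cd_rem₃ hδr hDs hJρ0 hJρ1 hJρ2 hD.one hD.two hD.three l m n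
  have b2 : ∀ i, |Torus.partialDeriv n (Torus.partialDeriv m (Torus.partialDeriv l
      (fun y => (u t y i - u₁ t y i) * Torus.partialDeriv i (ρ₁ t) y))) x -
      Torus.partialDeriv n (Torus.partialDeriv m (Torus.partialDeriv l (fun y => u t y i - u₁ t y i))) x *
        Torus.partialDeriv i (ρ₁ t) x| ≤
      3 * (d₂ * M) + 3 * (d₁ * (M * (1 + S₂))) + d₀ * (M * (1 + S₂ + S₃)) := fun i =>
    l3cd_rem₃ (hδvi i) (hr₁.partialDeriv i) (hJu0 i) (hJu1 i) (hJu2 i) (hR i).one (hR i).two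
      (hR i).three l m n
  have b3 : ∀ i, |Torus.partialDeriv n (Torus.partialDeriv m (fun y =>
      Torus.partialDeriv l (fun z => u t z i) y * Torus.partialDeriv i (fun z => ρ t z - ρ₁ t z) y)) x -
      Torus.partialDeriv l (fun y => u t y i) x *
        Torus.partialDeriv n (Torus.partialDeriv m (Torus.partialDeriv i (fun y => ρ t y - ρ₁ t y))) x| ≤
      2 * (M * (1 + S₂) * d₂) + M * (1 + S₂ + S₃) * d₁ := fun i =>
    l3cd_rem₂ ((hvi i).partialDeriv l) (hδr.partialDeriv i) (fun a => hu2 i l a) (fun a b => hu3 i l a b)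
      (hJρ1 i) (fun a => hJρ2 i a) m n
  have hg₀ : |∑ i, Torus.partialDeriv i (fun y => u t y i - u₁ t y i) x| ≤ 3 * d₁ := by
    rw [Fin.sum_univ_three]
    exact (abs_add_three _ _ _).trans (by linarith [hJu1 0 0, hJu1 1 1, hJu1 2 2])
  have hg₁ : ∀ a, |Torus.partialDeriv a
      (fun y => ∑ i, Torus.partialDeriv i (fun y => u t y i - u₁ t y i) y) x| ≤ 3 * d₂ := by
    intro a
    rw [Torus.partialDeriv_finset_sum Finset.univ (fun i _ => ((hδvi i).partialDeriv i).isContDiff (by simp))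
      a x, Fin.sum_univ_three]
    exact (abs_add_three _ _ _).trans (by linarith [hJu2 0 0 a, hJu2 1 1 a, hJu2 2 2 a])
  have b4 := l3cd_rem₂ (hr.partialDeriv l) hG1 (fun a => hρ2 l a) (fun a b => hρ3 l a b) hg₀ hg₁ m n
  rw [l3cd_dsum (fun i => (hδvi i).partialDeriv i) m, Torus.partialDeriv_finset_sum Finset.univ
    (fun i _ => (((hδvi i).partialDeriv i).partialDeriv m).isContDiff (by simp)) n x] at b4
  have b5 : ∀ i, |Torus.partialDeriv n (fun y => Torus.partialDeriv m (fun z => u t z i) y *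
      Torus.partialDeriv i (Torus.partialDeriv l (fun z => ρ t z - ρ₁ t z)) y) x -
      Torus.partialDeriv m (fun y => u t y i) x *
        Torus.partialDeriv n (Torus.partialDeriv i (Torus.partialDeriv l (fun y => ρ t y - ρ₁ t y))) x| ≤
      M * (1 + S₂) * d₂ := by
    intro i
    rw [Torus.partialDeriv_mul_sub ((hvi i).partialDeriv m) ((hδr.partialDeriv l).partialDeriv i) n x]
    exact l3cd_mm (hu2 i m n) (hJρ2 l i)
  have hG0 : |∑ i, Torus.partialDeriv i (Torus.partialDeriv l (fun y => u t y i - u₁ t y i)) x| ≤ 3 * d₂ := by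
    rw [Fin.sum_univ_three]
    exact (abs_add_three _ _ _).trans (by linarith [hJu2 0 l 0, hJu2 1 l 1, hJu2 2 l 2])
  have b6 : |Torus.partialDeriv n (fun y => Torus.partialDeriv m (ρ t) y *
      ∑ i, Torus.partialDeriv i (Torus.partialDeriv l (fun z => u t z i - u₁ t z i)) y) x -
      Torus.partialDeriv m (ρ t) x *
        ∑ i, Torus.partialDeriv n (Torus.partialDeriv i (Torus.partialDeriv l
          (fun y => u t y i - u₁ t y i))) x| ≤ M * (1 + S₂) * (3 * d₂) := by
    rw [← Torus.partialDeriv_finset_sum Finset.univ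
        (fun i _ => (((hδvi i).partialDeriv l).partialDeriv i).isContDiff (by simp)) n x,
      Torus.partialDeriv_mul_sub (hr.partialDeriv m) hG2 n x]
    exact l3cd_mm (hρ2 m n) hG0
  have hRem : 3 * (d₂ * M) + 3 * (d₁ * (M * (1 + S₂))) + d₀ * (M * (1 + S₂ + S₃)) +
      3 * (3 * (d₂ * M) + 3 * (d₁ * (M * (1 + S₂))) + d₀ * (M * (1 + S₂ + S₃))) +
      3 * (2 * (M * (1 + S₂) * d₂) + M * (1 + S₂ + S₃) * d₁) +
      (2 * (M * (1 + S₂) * (3 * d₂)) + M * (1 + S₂ + S₃) * (3 * d₁)) +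
      3 * (M * (1 + S₂) * d₂) + M * (1 + S₂) * (3 * d₂) ≤ l3Rem M Z S₂ S₃ d₀ d₁ d₂ := by
    unfold l3Rem
    have h1 : 0 ≤ M * d₂ := mul_nonneg hM hd₂
    have h3 : 0 ≤ M * d₁ := mul_nonneg hM hd₁
    have h6 : 0 ≤ M * d₀ := mul_nonneg hM hd₀
    have h9 : 0 ≤ Z * (1 + S₂ + S₃) := by positivity
    nlinarith [mul_nonneg h1 hS₂, mul_nonneg h3 hS₂, mul_nonneg h3 hS₃, mul_nonneg h6 hS₂,
      mul_nonneg h6 hS₃]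
  exact l3cd_alg b1 b2 b3 b4 b5 b6 hRem

end Summit.AtomisticToContinuum.HydrodynamicLimit.Theorems

end
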